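import Literature.AlgebraicGeometry.Motives.GrassmannianChartSchemeRange
import Literature.AlgebraicGeometry.Motives.GrassmannianChartLocusScheme
import Literature.AlgebraicGeometry.Motives.SubsheafRangeOfBijectiveOnSpec
import Literature.AlgebraicGeometry.Motives.OpenSubfunctorCover
import HarnessLib

/-!
# The Grassmannian functor is representable by a scheme

Topic `AlgebraicGeometry/Motives`; namespace `Literature.AlgebraicGeometry.Motives.Grassmannian`.  THEOREMS ONLY.
(h4) brick (A4) of the interface memo `A34-INTERFACE` (B-p21 (g15)): the assembly of

* the Zariski sheaf `grassmannianSheaf M k` on `Scheme.{u}` extending `A ↦ G(k, A ⊗_ℤ M; A)` (B-p21 (D1)–(D3), over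
  the big Zariski comparison lemma `ZariskiSheavesOnAffineSchemes`),
* the standard charts `chartMap I : h_{Spec ℤ[X]} → Gr` of a basis `b` of `M` (B-p18 `GrassmannianChartScheme[Range]`,
  (C1)–(C5)), injective on all `T`-points, covering the field-valued points,
* the chart subfunctors `chartSubsheaf (b ∘ I)` cut out by the OPEN condition `chartLocus` (B-p09
  `GrassmannianChartLocusScheme`, `PointwiseOpenCondition`, C3-inst) and the identification
  «image of `chartMap I` = `chartSubsheaf (b ∘ I)`» (B-p21 `SubsheafRangeOfBijectiveOnSpec`),

fed into `isRepresentable_of_openCondition_cover` (`OpenSubfunctorCover`, Görtz–Wedhorn Thm. 8.9 over Mathlib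
`Scheme.LocalRepresentability`):

* `chartElem_mem_chartSubsheaf`, `bijective_chartMap_Spec`, `range_chartMap_app_eq` — the chart map co-restricts to a
  morphism onto `chartSubsheaf (b ∘ I)`, bijective on affine schemes, hence with image `chartSubsheaf` on every `T`.
* **`isRepresentable_grassmannianSheaf_of_basis`**, **`isRepresentable_grassmannianSheaf`** — for a free abelian group
  `M` (any rank, any basis index type in `Type u`) and any `k`, `(grassmannianSheaf M k).obj.IsRepresentable`: **the
  Grassmannian functor `A ↦ G(k, A ⊗_ℤ M; A)` is representable by a scheme** (B-p21 (D3) §4 then names it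
  `grassmannianScheme M k` with `(Spec A ⟶ grassmannianScheme M k) ≃ Module.Grassmannian A (A ⊗[ℤ] M) k`).

References: [GortzWedhorn2020] (8.4) Lemma 8.13, Thm. 8.9, Cor. 8.15; [StacksProject, Tag 089T].  Cell `hodgecm-mathlib`,
F-DAG first hand (h4) — count-neutral Mathlib-side capital; HC_CM is proved only modulo the 7 printed citations until rung 0
closes.
-/

namespace Literature.AlgebraicGeometry.Motives.Grassmannian

open CategoryTheory Opposite TensorProduct _root_.AlgebraicGeometry

universe u

/-- **The universal chart element lies in the chart subfunctor** (`specEquiv chartElem = chartElemAffine ∈ chart`).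
[cite: GortzWedhorn2020, (8.4), Lemma 8.13 (p. 215)] -/
theorem chartElem_mem_chartSubsheaf (k : ℕ) (M : Type u) [AddCommGroup M] {J : Type u} (b : Module.Basis J ℤ M)
    (I : Fin k → J) (hI : Function.Injective I) :
    chartElem k M b I hI ∈ (chartSubsheaf M k (⇑b ∘ I)).obj (op (chartScheme k I)) := by
  rw [mem_chartSubsheaf_Spec_iff, specEquiv_chartElem]
  exact chartElemAffine_mem_chart k M b I hI

/-- **The chart map co-restricted to the chart subfunctor is bijective on every affine scheme** (injective: B-p18
`chartMap_app_injective_Spec`; onto `chartSubsheaf (b ∘ I) (Spec A)`: `mem_chartSubsheaf_Spec_iff` + B-p18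
`mem_range_chartMap_app_Spec_of_mem_chart`, i.e. (C4)). [cite: GortzWedhorn2020, (8.4), Lemma 8.13 (p. 215)] -/
theorem bijective_chartMap_Spec (k : ℕ) (M : Type u) [AddCommGroup M] {J : Type u} (b : Module.Basis J ℤ M)
    (I : Fin k → J) (hI : Function.Injective I) (A : CommRingCat.{u}) :
    Function.Bijective fun g : Spec A ⟶ chartScheme k I =>
      (⟨(grassmannianSheaf M k).obj.map g.op (chartElem k M b I hI),
        (chartSubsheaf M k (⇑b ∘ I)).map g.op (chartElem_mem_chartSubsheaf k M b I hI)⟩ :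
        (chartSubsheaf M k (⇑b ∘ I)).toFunctor.obj (op (Spec A))) := by
  constructor
  · intro g g' h
    have h' := congrArg Subtype.val h
    simp only [← chartMap_app_apply] at h'
    exact chartMap_app_injective_Spec k M b I hI A h'
  · rintro ⟨y, hy⟩
    rw [mem_chartSubsheaf_Spec_iff] at hy
    obtain ⟨g, hg⟩ := mem_range_chartMap_app_Spec_of_mem_chart k M b I hI A y hy
    refine ⟨g, Subtype.ext ?_⟩
    simp only [← chartMap_app_apply]
    exact hg

/-- **Image of the chart map = the chart subfunctor, on every scheme** (B-p21
`range_yonedaEquiv_symm_app_eq_of_bijective_Spec`: a morphism of Zariski sheaves bijective on affines is an isomorphism).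
[cite: GortzWedhorn2020, (8.4), Lemma 8.13 (p. 215)] -/
theorem range_chartMap_app_eq (k : ℕ) (M : Type u) [AddCommGroup M] {J : Type u} (b : Module.Basis J ℤ M)
    (I : Fin k → J) (hI : Function.Injective I) (T : Scheme.{u}) :
    Set.range ((chartMap k M b I hI).app (op T)) = (chartSubsheaf M k (⇑b ∘ I)).obj (op T) :=
  range_yonedaEquiv_symm_app_eq_of_bijective_Spec (F := grassmannianSheaf M k) (chartSubsheaf M k (⇑b ∘ I))
    (chartElem k M b I hI) (isSheaf_chartSubsheaf M k (⇑b ∘ I)) (chartElem_mem_chartSubsheaf k M b I hI)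
    (bijective_chartMap_Spec k M b I hI) T

/-- **THE GRASSMANNIAN FUNCTOR IS REPRESENTABLE (basis form)**: for an abelian group `M` with a basis `b : J → M`
(`J : Type u`) and `k : ℕ`, the Zariski sheaf `grassmannianSheaf M k` — whose affine points are Mathlib's
`Module.Grassmannian A (A ⊗[ℤ] M) k` — is representable by a scheme, glued from the affine charts `Spec ℤ[X_I]`,
`I : Fin k ↪ J` (`isRepresentable_of_openCondition_cover`). [cite: GortzWedhorn2020, Thm. 8.9 (p. 212)]
[cite: StacksProject, Tag 089T] -/
theorem isRepresentable_grassmannianSheaf_of_basis (k : ℕ) (M : Type u) [AddCommGroup M] {J : Type u}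
    (b : Module.Basis J ℤ M) : (grassmannianSheaf M k).obj.IsRepresentable := by
  refine isRepresentable_of_openCondition_cover (grassmannianSheaf M k)
    (ι := {I : Fin k → J // Function.Injective I}) (X := fun I => chartScheme k I.1)
    (fun I => chartMap k M b I.1 I.2) (fun I T => chartMap_app_injective k M b I.1 I.2 T)
    (fun I {T} y => chartLocus (⇑b ∘ I.1) y) (fun I {T T'} y h => ?_) (fun K _ y => ?_)
  · rw [range_chartMap_app_eq, ← map_mem_chartSubsheaf_iff]
  · obtain ⟨I, hI⟩ := exists_mem_range_chartMap_app_of_field k M b K y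
    exact ⟨I, hI⟩

/-- **THE GRASSMANNIAN FUNCTOR IS REPRESENTABLE**: for a free abelian group `M` (in `Type u`) and `k : ℕ`,
`(grassmannianSheaf M k).obj.IsRepresentable` — so B-p21's `grassmannianScheme M k` (defined under this instance) exists, with
`(Spec A ⟶ grassmannianScheme M k) ≃ Module.Grassmannian A (A ⊗[ℤ] M) k` naturally in `A` (`specPointsEquiv`).
[cite: GortzWedhorn2020, Thm. 8.9 (p. 212)] [cite: StacksProject, Tag 089T] -/
theorem isRepresentable_grassmannianSheaf (M : Type u) [AddCommGroup M] [Module.Free ℤ M] (k : ℕ) :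
    (grassmannianSheaf M k).obj.IsRepresentable :=
  isRepresentable_grassmannianSheaf_of_basis k M (Module.Free.chooseBasis ℤ M)

end Literature.AlgebraicGeometry.Motives.Grassmannian
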